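import Summits.CriticalPhenomena.PercolationContinuityZ3.Theorems.PercNearOneGluingNoHeavyLowerTailDualBHK
import Summits.CriticalPhenomena.PercolationContinuityZ3.Theorems.PercNearOneGluingNoHeavyLowerTailCubicThreePointApexCasesA
import HarnessLib

/-!
# `NoHeavyLowerTail` (stmt-CriticalPhenomena-4575) — the dual BHK inequality in its conditional forms

Support file (prover prim-ineq-gen-2 gen 7; `--supports stmt-CriticalPhenomena-4575`).  Corollaries of the tree theorem
`DualBHK.dualBHK` (`t · n′ ≤ u₁ · u₂`, file `…DualBHK.lean`, memo run/shared/lean/prim/prim-ineq-gen-2/DUAL-BHK.md §1, §8) in the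
forms a reader would cite:

* the EVENT `{S | Sep E K S a b c}` = "the open cluster of `a` separates `b` from `c` in the support graph `E`" (every `b–c` path of `E`
  meets the cluster, `CubicThreePointApex.Sep`) and its mass `P(Sep) = t + u₁ + u₂ + n′` (`PrW_evSep`: the cells `abc`, `ab|c`, `ac|b`
  separate trivially because `b` or `c` lies in the cluster; `bc|a` never separates; `a|b|c` splits into `N′ ⊔ W`);
* (F2) `P(abc) · P(Sep) ≤ P(a ~ b) · P(a ~ c)` (`t_mul_sep_le`), i.e. (F3) GIVEN that the cluster of `a` separates `b` from `c`, the events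
  `{a ~ b}` and `{a ~ c}` (both of which imply the separation) are NEGATIVELY correlated — the one-cluster 'fencing' twin of
  van den Berg–Häggström–Kahn's two-cluster inequality `P(s~x, t~y | s ≁ t) ≤ P(s~x | s≁t) P(t~y | s≁t)`;
* (F4) the covariance form `P(abc) − P(a~b)P(a~c) ≤ P(abc) · P(¬Sep)` (`cov_ab_ac_le`): Harris' inequality `P(ab ∧ ac) ≥ P(ab)P(ac)` over-shoots by
  at most `P(abc)` times the probability that some `b–c` path of the support avoids the cluster of `a`.

All statements are for an arbitrary support `E ⊇ D ∪ K` (larger supports only make separation harder, `PrW_evNp_anti`) and `b ≠ c`.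
No named facts, no sorries.  [this work]
-/

noncomputable section

namespace Summit.CriticalPhenomena.PercolationContinuityZ3.Theorems

namespace DualBHKSep

open Finset SimpleGraph Literature.Probability.Percolation.DecisionTree CubicThreePointStep CubicThreePointApex

variable {V : Type*} [DecidableEq V]

/-! ### The separation event and the two-point events -/

/-- If `b` lies in the cluster of `a` (and `b ≠ c`), the cluster separates `b` from `c`: the trivial endpoint `b` of every `b–c` path
is a cluster vertex. [folklore] -/
theorem Sep_of_R_left {E K S : Finset (Sym2 V)} {a b c : V} (hbc : b ≠ c) (h : R K S a b) : CubicThreePointApex.Sep E K S a b c := by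
  rintro ⟨w⟩
  cases w with
  | nil => exact hbc rfl
  | cons hadj _ =>
    rw [fromEdgeSet_adj, Set.mem_setOf_eq] at hadj
    exact hadj.1.2 b (Sym2.mem_mk_left _ _) h

/-- `Sep` is symmetric in `b, c`. [folklore] -/
theorem Sep_comm {E K S : Finset (Sym2 V)} {a b c : V} : CubicThreePointApex.Sep E K S a b c ↔ CubicThreePointApex.Sep E K S a c b := by
  unfold CubicThreePointApex.Sep
  rw [SimpleGraph.reachable_comm]

/-- If `c` lies in the cluster of `a` (and `b ≠ c`), the cluster separates `b` from `c`. [folklore] -/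
theorem Sep_of_R_right {E K S : Finset (Sym2 V)} {a b c : V} (hbc : b ≠ c) (h : R K S a c) : CubicThreePointApex.Sep E K S a b c :=
  Sep_comm.2 (Sep_of_R_left hbc.symm h)

/-- On `bc|a` the cluster of `a` does not separate: the open `b–c` path lies in the support and avoids the cluster. [folklore] -/
theorem not_Sep_of_evU₃ {E K S : Finset (Sym2 V)} {a b c : V} (hE : ∀ f, f ∈ S ∪ K → f ∈ E) (h : S ∈ evU₃ K a b c) :
    ¬ CubicThreePointApex.Sep E K S a b c :=
  not_Sep_of_reach (K' := K) h.1 hE fun _ hbz haz => h.2 (haz.trans hbz.symm)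

/-! ### Masses: `P(Sep) = t + u₁ + u₂ + n′`, `P(a~b) = t + u₁`, `P(a~c) = t + u₂`, `P(¬Sep) = 1 − P(Sep)` -/

/-- Pointwise: `1[Sep] = 1[abc] + 1[ab|c] + 1[ac|b] + 1[N′]` (for `b ≠ c`, support containing the open and forced edges). [this work] -/
theorem ind_evSep {E K S : Finset (Sym2 V)} {a b c : V} (hbc : b ≠ c) (hE : ∀ f, f ∈ S ∪ K → f ∈ E) :
    ind ({S | CubicThreePointApex.Sep E K S a b c}) S =
      ind (evT K a b c) S + ind (evU₁ K a b c) S + ind (evU₂ K a b c) S + ind (evNp E K a b c) S := by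
  by_cases hab : R K S a b
  · have hS : S ∈ {S | CubicThreePointApex.Sep E K S a b c} := Sep_of_R_left hbc hab
    have h2 : S ∉ evU₂ K a b c := fun h => h.2 hab
    have hN : S ∉ evNp E K a b c := fun h => h.1.1 hab
    by_cases hac : R K S a c
    · have hT : S ∈ evT K a b c := ⟨hab, hac⟩
      have h1 : S ∉ evU₁ K a b c := fun h => h.2 hac
      rw [ind_of_mem hS, ind_of_mem hT, ind_of_not_mem h1, ind_of_not_mem h2, ind_of_not_mem hN]; ring
    · have hT : S ∉ evT K a b c := fun h => hac h.2
      have h1 : S ∈ evU₁ K a b c := ⟨hab, hac⟩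
      rw [ind_of_mem hS, ind_of_not_mem hT, ind_of_mem h1, ind_of_not_mem h2, ind_of_not_mem hN]; ring
  · have hT : S ∉ evT K a b c := fun h => hab h.1
    have h1 : S ∉ evU₁ K a b c := fun h => hab h.1
    by_cases hac : R K S a c
    · have hS : S ∈ {S | CubicThreePointApex.Sep E K S a b c} := Sep_of_R_right hbc hac
      have h2 : S ∈ evU₂ K a b c := ⟨hac, hab⟩
      have hN : S ∉ evNp E K a b c := fun h => h.1.2.1 hac
      rw [ind_of_mem hS, ind_of_not_mem hT, ind_of_not_mem h1, ind_of_mem h2, ind_of_not_mem hN]; ring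
    · have h2 : S ∉ evU₂ K a b c := fun h => hac h.1
      by_cases hbc' : R K S b c
      · have h3 : S ∈ evU₃ K a b c := ⟨hbc', hab⟩
        have hS : S ∉ {S | CubicThreePointApex.Sep E K S a b c} := not_Sep_of_evU₃ hE h3
        have hN : S ∉ evNp E K a b c := fun h => h.1.2.2 hbc'
        rw [ind_of_not_mem hS, ind_of_not_mem hT, ind_of_not_mem h1, ind_of_not_mem h2, ind_of_not_mem hN]; ring
      · by_cases hs : CubicThreePointApex.Sep E K S a b c
        · have hS : S ∈ {S | CubicThreePointApex.Sep E K S a b c} := hs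
          have hN : S ∈ evNp E K a b c := ⟨⟨hab, hac, hbc'⟩, hs⟩
          rw [ind_of_mem hS, ind_of_not_mem hT, ind_of_not_mem h1, ind_of_not_mem h2, ind_of_mem hN]; ring
        · have hS : S ∉ {S | CubicThreePointApex.Sep E K S a b c} := hs
          have hN : S ∉ evNp E K a b c := fun h => hs h.2
          rw [ind_of_not_mem hS, ind_of_not_mem hT, ind_of_not_mem h1, ind_of_not_mem h2, ind_of_not_mem hN]; ring

/-- Pointwise: `1[a ~ b] = 1[abc] + 1[ab|c]`. [folklore] -/
theorem ind_evR_ab {K S : Finset (Sym2 V)} {a b c : V} :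
    ind ({S | R K S a b}) S = ind (evT K a b c) S + ind (evU₁ K a b c) S := by
  by_cases hab : R K S a b
  · have hS : S ∈ {S | R K S a b} := hab
    by_cases hac : R K S a c
    · have hT : S ∈ evT K a b c := ⟨hab, hac⟩
      have h1 : S ∉ evU₁ K a b c := fun h => h.2 hac
      rw [ind_of_mem hS, ind_of_mem hT, ind_of_not_mem h1]; ring
    · have hT : S ∉ evT K a b c := fun h => hac h.2
      have h1 : S ∈ evU₁ K a b c := ⟨hab, hac⟩
      rw [ind_of_mem hS, ind_of_not_mem hT, ind_of_mem h1]; ring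
  · have hS : S ∉ {S | R K S a b} := hab
    have hT : S ∉ evT K a b c := fun h => hab h.1
    have h1 : S ∉ evU₁ K a b c := fun h => hab h.1
    rw [ind_of_not_mem hS, ind_of_not_mem hT, ind_of_not_mem h1]; ring

/-- Pointwise: `1[a ~ c] = 1[abc] + 1[ac|b]`. [folklore] -/
theorem ind_evR_ac {K S : Finset (Sym2 V)} {a b c : V} :
    ind ({S | R K S a c}) S = ind (evT K a b c) S + ind (evU₂ K a b c) S := by
  by_cases hac : R K S a c
  · have hS : S ∈ {S | R K S a c} := hac
    by_cases hab : R K S a b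
    · have hT : S ∈ evT K a b c := ⟨hab, hac⟩
      have h2 : S ∉ evU₂ K a b c := fun h => h.2 hab
      rw [ind_of_mem hS, ind_of_mem hT, ind_of_not_mem h2]; ring
    · have hT : S ∉ evT K a b c := fun h => hab h.1
      have h2 : S ∈ evU₂ K a b c := ⟨hac, hab⟩
      rw [ind_of_mem hS, ind_of_not_mem hT, ind_of_mem h2]; ring
  · have hS : S ∉ {S | R K S a c} := hac
    have hT : S ∉ evT K a b c := fun h => hac h.2
    have h2 : S ∉ evU₂ K a b c := fun h => hac h.1
    rw [ind_of_not_mem hS, ind_of_not_mem hT, ind_of_not_mem h2]; ring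

/-- Pointwise: `1 = 1[Sep] + 1[¬Sep]`. [folklore] -/
theorem ind_univ_sep {E K S : Finset (Sym2 V)} {a b c : V} :
    ind (Set.univ : Set (Finset (Sym2 V))) S = ind ({S | CubicThreePointApex.Sep E K S a b c}) S + ind ({S | CubicThreePointApex.Sep E K S a b c})ᶜ S := by
  rw [ind_of_mem (Set.mem_univ S)]
  by_cases hs : S ∈ {S | CubicThreePointApex.Sep E K S a b c}
  · rw [ind_of_mem hs, ind_of_not_mem (fun h => (Set.mem_compl_iff _ _).1 h hs)]; ring
  · rw [ind_of_not_mem hs, ind_of_mem (Set.mem_compl hs)]; ring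

variable (D : Finset (Sym2 V)) (p : Sym2 V → ℝ)

/-- `P(Sep) = t + u₁ + u₂ + n′` whenever the support contains the random and the forced edges. [this work] -/
theorem PrW_evSep {E K : Finset (Sym2 V)} (hE : D ∪ K ⊆ E) {a b c : V} (hbc : b ≠ c) :
    PrW D p ({S | CubicThreePointApex.Sep E K S a b c}) =
      PrW D p (evT K a b c) + PrW D p (evU₁ K a b c) + PrW D p (evU₂ K a b c) + PrW D p (evNp E K a b c) :=
  PrW_of_ind_add4 D p fun S hS => ind_evSep hbc fun f hf => hE (by
    rw [Finset.mem_union] at hf ⊢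
    exact hf.imp_left fun h => hS h)

/-- `P(a ~ b) = t + u₁`. [folklore] -/
theorem PrW_evR_ab (K : Finset (Sym2 V)) (a b c : V) :
    PrW D p ({S | R K S a b}) = PrW D p (evT K a b c) + PrW D p (evU₁ K a b c) :=
  PrW_of_ind_add D p fun _ _ => ind_evR_ab

/-- `P(a ~ c) = t + u₂`. [folklore] -/
theorem PrW_evR_ac (K : Finset (Sym2 V)) (a b c : V) :
    PrW D p ({S | R K S a c}) = PrW D p (evT K a b c) + PrW D p (evU₂ K a b c) :=
  PrW_of_ind_add D p fun _ _ => ind_evR_ac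

/-- `P(¬Sep) = 1 − P(Sep)`. [folklore] -/
theorem PrW_compl_evSep (E K : Finset (Sym2 V)) (a b c : V) :
    PrW D p ({S | CubicThreePointApex.Sep E K S a b c})ᶜ = 1 - PrW D p ({S | CubicThreePointApex.Sep E K S a b c}) := by
  have h := PrW_of_ind_add D p (A := Set.univ) (B := {S | CubicThreePointApex.Sep E K S a b c}) (C := ({S | CubicThreePointApex.Sep E K S a b c})ᶜ) fun S _ => ind_univ_sep
  rw [PrW_univ] at h
  linarith

/-! ### The conditional forms of the dual BHK inequality -/

/-- **(F2) Dual BHK, separation form.**  `P(abc) · P(C_a separates b from c) ≤ P(a ~ b) · P(a ~ c)` on every finite weighted graph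
(support `E ⊇ D ∪ K`, `b ≠ c`).  Since `{a~b}, {a~c} ⊆ Sep(b,c)`, this says (F3): conditionally on the separation, `{a ~ b}` and `{a ~ c}`
are negatively correlated.  [this work] -/
theorem t_mul_sep_le {p : Sym2 V → ℝ} (hp0 : ∀ e, 0 ≤ p e) (hp1 : ∀ e, p e ≤ 1) (D K : Finset (Sym2 V)) {E : Finset (Sym2 V)}
    (hE : D ∪ K ⊆ E) {a b c : V} (hbc : b ≠ c) :
    PrW D p (evT K a b c) * PrW D p ({S | CubicThreePointApex.Sep E K S a b c}) ≤ PrW D p ({S | R K S a b}) * PrW D p ({S | R K S a c}) := by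
  have hd := DualBHK.dualBHK' hp0 hp1 D K a b c
  have hn : PrW D p (evNp E K a b c) ≤ PrW D p (evNp (D ∪ K) K a b c) := PrW_evNp_anti D hp0 hp1 hE K a b c
  have ht : 0 ≤ PrW D p (evT K a b c) := PrW_nonneg D hp0 hp1 _
  have htn := mul_le_mul_of_nonneg_left hn ht
  rw [PrW_evSep D p hE hbc, PrW_evR_ab D p K a b c, PrW_evR_ac D p K a b c]
  nlinarith [htn, hd]

/-- **(F3) Dual BHK, conditional-correlation form.**  `P(ab ∧ ac ∧ Sep) · P(Sep) ≤ P(ab ∧ Sep) · P(ac ∧ Sep)`: given that the open cluster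
of `a` separates `b` from `c`, the increasing events `{a ~ b}`, `{a ~ c}` are negatively correlated (all three intersections with `Sep`
are the events themselves, as `a ~ b` or `a ~ c` forces the separation). [this work] -/
theorem condNegCorr_sep {p : Sym2 V → ℝ} (hp0 : ∀ e, 0 ≤ p e) (hp1 : ∀ e, p e ≤ 1) (D K : Finset (Sym2 V)) {E : Finset (Sym2 V)}
    (hE : D ∪ K ⊆ E) {a b c : V} (hbc : b ≠ c) :
    PrW D p ({S | R K S a b} ∩ {S | R K S a c} ∩ {S | CubicThreePointApex.Sep E K S a b c}) * PrW D p ({S | CubicThreePointApex.Sep E K S a b c}) ≤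
      PrW D p ({S | R K S a b} ∩ {S | CubicThreePointApex.Sep E K S a b c}) * PrW D p ({S | R K S a c} ∩ {S | CubicThreePointApex.Sep E K S a b c}) := by
  have e1 : PrW D p ({S | R K S a b} ∩ {S | R K S a c} ∩ {S | CubicThreePointApex.Sep E K S a b c}) = PrW D p (evT K a b c) :=
    PrW_of_ind_eq D p fun S _ => by
      by_cases h : S ∈ evT K a b c
      · rw [ind_of_mem h, ind_of_mem (show S ∈ {S | R K S a b} ∩ {S | R K S a c} ∩ {S | CubicThreePointApex.Sep E K S a b c} from
          ⟨⟨h.1, h.2⟩, Sep_of_R_left hbc h.1⟩)]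
      · rw [ind_of_not_mem h, ind_of_not_mem (show S ∉ {S | R K S a b} ∩ {S | R K S a c} ∩ {S | CubicThreePointApex.Sep E K S a b c} from
          fun h' => h ⟨h'.1.1, h'.1.2⟩)]
  have e2 : PrW D p ({S | R K S a b} ∩ {S | CubicThreePointApex.Sep E K S a b c}) = PrW D p ({S | R K S a b}) :=
    PrW_of_ind_eq D p fun S _ => by
      by_cases h : S ∈ {S | R K S a b}
      · rw [ind_of_mem h, ind_of_mem (show S ∈ {S | R K S a b} ∩ {S | CubicThreePointApex.Sep E K S a b c} from ⟨h, Sep_of_R_left hbc h⟩)]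
      · rw [ind_of_not_mem h, ind_of_not_mem (show S ∉ {S | R K S a b} ∩ {S | CubicThreePointApex.Sep E K S a b c} from fun h' => h h'.1)]
  have e3 : PrW D p ({S | R K S a c} ∩ {S | CubicThreePointApex.Sep E K S a b c}) = PrW D p ({S | R K S a c}) :=
    PrW_of_ind_eq D p fun S _ => by
      by_cases h : S ∈ {S | R K S a c}
      · rw [ind_of_mem h, ind_of_mem (show S ∈ {S | R K S a c} ∩ {S | CubicThreePointApex.Sep E K S a b c} from ⟨h, Sep_of_R_right hbc h⟩)]
      · rw [ind_of_not_mem h, ind_of_not_mem (show S ∉ {S | R K S a c} ∩ {S | CubicThreePointApex.Sep E K S a b c} from fun h' => h h'.1)]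
  rw [e1, e2, e3]
  exact t_mul_sep_le hp0 hp1 D K hE hbc

/-- **(F4) Dual BHK, covariance form.**  `P(abc) − P(a~b)·P(a~c) ≤ P(abc) · P(¬Sep)`: the Harris–FKG excess of the two connection events
at `a` is at most `P(abc)` times the probability that some `b–c` path of the support avoids the open cluster of `a`. [this work] -/
theorem cov_ab_ac_le {p : Sym2 V → ℝ} (hp0 : ∀ e, 0 ≤ p e) (hp1 : ∀ e, p e ≤ 1) (D K : Finset (Sym2 V)) {E : Finset (Sym2 V)}
    (hE : D ∪ K ⊆ E) {a b c : V} (hbc : b ≠ c) :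
    PrW D p (evT K a b c) - PrW D p ({S | R K S a b}) * PrW D p ({S | R K S a c}) ≤
      PrW D p (evT K a b c) * PrW D p ({S | CubicThreePointApex.Sep E K S a b c})ᶜ := by
  rw [PrW_compl_evSep D p E K a b c]
  have h := t_mul_sep_le (a := a) hp0 hp1 D K hE hbc
  nlinarith [h]

end DualBHKSep

end Summit.CriticalPhenomena.PercolationContinuityZ3.Theorems
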